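import Literature.NumberTheory.Automorphic.UnitarySliceGroupCoordinate        -- ⊙ (D1b): group coordinates `ζ` on the slice factor; ★ (D1a) through it
import Literature.LinearAlgebra.Matrix.BlockCentralizerNearScalar              -- ★ (W-s): Weyl separation at `ε = a·1 ⊕ u·1` in frame form
import HarnessLib

/-!
# The SLICE DATUM of a unitary group `U(σ, J)` at a SEMISIMPLE point, III: the chart `(a, m) ↦ s(a)·m·s(a)⁻¹` on `A × Z_U(γ)` with its saturated,
# `Z_U(γ)`-separated compact-open boxes — the assembled HEAD at `γ = P (a·1 ⊕ u·1) P⁻¹`, `a ≠ u` (N6nsGerm (S1)∕(S2), brick (D1), part c)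

Topic `NumberTheory/Automorphic`; namespace `Literature.NumberTheory.Automorphic`. KERNEL mathematics only: theorems, no definition, no named fact, no
instance, no notation, no `sorry`.  Cell `pub/hodgecm-mathlib` (LEAD F0P3a-plan (g9) WORD T8-38 (1), road «N6nsGerm» of A-p12 (g18) ∕ F0P2-p02 (g8), census
`CENSUS-N6nsGerm-S1.A-p16g26.md` brick (D1)).  Harish-Chandra's descent of orbital integrals at a SINGULAR semisimple `γ ∈ U = U(σ, J)` (Rogawski 1990
Prop. 8.2.1; Langlands–Shelstad 1990 Thm. 2.3.A) needs: a chart `eT(a, m) = s(a) m s(a)⁻¹ : A × Z_U(γ) → U` around `(a₀, γ)` (GROUP coordinates on the slice),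
and arbitrarily small compact-open boxes `K × B₁ ⊆ eT.source` which are SATURATED (`x m x⁻¹ ∈ eT(K × B₁) ⇒ x ∈ s(K)·Z_U(γ)`) and `Z_U(γ)`-SEPARATED
(`y m y⁻¹ = m′` with `m, m′ ∈ B₁` ⇒ `y ∈ Z_U(γ)`: `U`-classes near `γ` meeting `B₁` are `Z_U(γ)`-classes).  Parts I–II (★ `UnitarySliceChart`,
⊙ `UnitarySliceGroupCoordinate`) give the chart in algebra coordinates, the generic box clause from Weyl separation, and the group coordinate `ζ`; ★ (W-s)
`BlockCentralizerNearScalar.eventually_commute_of_mul_eq_of_frame` gives Weyl separation at `γ = P (a·1 ⊕ u·1) P⁻¹`.  This file composes them.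

* §1 GENERIC **`exists_slice_groupDatum_of_sliceDatum`** — from an abstract slice datum with its box clause and a group coordinate `ζ : B → T` (the package of
  part II), the chart `eT := (refl A × ζ⁻¹) ≫ e` on `A × T` with `eT(a, t) = s(a) t s(a)⁻¹` and the box clause transported (★ `UnitaryCayleyChartDatumTorus`'s
  composition, verbatim on the slice clause).
* §2 HEAD **`exists_unitary_sliceDatum`** (`E` a complete proper totally disconnected non-trivially normed field of characteristic zero — the non-archimedean local
  fields; `γ ∈ U(σ, J)` with an adapted frame `γ P = P · reindex (a·1 ⊕ u·1)`, `a ≠ u`).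

HONEST SCOPE.  Point-set topology of matrix groups only.  HC_CM is proved only modulo the printed citations until rung 0 closes; this file discharges no printed
statement (it is the chart half of the descent (D1); the measure half (D2) binds these heads).

## References
* [HarishChandra1970] Harish-Chandra (notes by G. van Dijk), *Harmonic Analysis on Reductive p-adic Groups*, LNM 162 (1970), Part II §5 (descent to `M = Z_G(γ)`).
* [Rogawski1990] J. D. Rogawski, *Automorphic Representations of Unitary Groups in Three Variables*, Ann. of Math. Stud. 123 (1990), §8.2 Prop. 8.2.1 pp. 112–116.
* [Weyl1939] H. Weyl, *The Classical Groups* (1939), Ch. II §10.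
-/

set_option autoImplicit false

noncomputable section

open Set Filter Topology Polynomial
open Literature.Analysis.Calculus Literature.LinearAlgebra.Matrix
open scoped Matrix.Norms.Operator Matrix MatrixGroups Pointwise

namespace Literature.NumberTheory.Automorphic

/-! ## §1 GENERIC: composing a slice datum with a group coordinate on the slice factor -/

section Subgroup

variable {E : Type*} [Field E] [TopologicalSpace E]
  {n : Type*} [Fintype n] [DecidableEq n] {U : Subgroup (GL n E)}
  {A B : Type*} [TopologicalSpace A] [TopologicalSpace B]

/-- **Slice datum in GROUP coordinates.** Given an abstract slice datum `e(a, b) = s(a) τ(b) s(a)⁻¹` with `τ(B) ⊆ T` and its box clause (SAT)∕(SEP′) with respect to `T`,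
and a group coordinate `ζ : B → T` (an open partial homeomorphism with `ζ.source = B₀ ∋ b₀`, `{a₀} × B₀ ⊆ e.source`, `↑(ζ b) = τ b`), the chart
`eT := (refl A × ζ⁻¹) ≫ e : A × T → U` satisfies `eT(a, t) = s(a)·t·s(a)⁻¹` on its source, `(a₀, ζ b₀) ∈ eT.source`, and inherits the box clause.
[cite: HarishChandra1970, Part II §5] [cite: Rogawski1990, §8.2 Prop. 8.2.1 p. 112] -/
theorem exists_slice_groupDatum_of_sliceDatum (T : Subgroup ↥U) (s : A → ↥U) (τ : B → ↥U) (hτ : Continuous τ) (e : OpenPartialHomeomorph (A × B) ↥U)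
    (he : ∀ p ∈ e.source, e p = s p.1 * τ p.2 * (s p.1)⁻¹) {a₀ : A} {b₀ : B} (hcomm : ∀ b, τ b ∈ T)
    (hbox : ∀ N ∈ 𝓝 (a₀, b₀), ∃ (K : Set A) (B₁ : Set B), IsCompact K ∧ IsOpen K ∧ a₀ ∈ K ∧ IsCompact B₁ ∧ IsOpen B₁ ∧ b₀ ∈ B₁ ∧
      K ×ˢ B₁ ⊆ N ∧ K ×ˢ B₁ ⊆ e.source ∧
      (∀ b ∈ B₁, ∀ x : ↥U, x * τ b * x⁻¹ ∈ e '' (K ×ˢ B₁) → x ∈ s '' K * (T : Set ↥U)) ∧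
      (∀ b ∈ B₁, ∀ b' ∈ B₁, ∀ y : ↥U, y * τ b * y⁻¹ = τ b' → y ∈ T))
    (B₀ : Set B) (ζ : OpenPartialHomeomorph B ↥T) (hB₀o : IsOpen B₀) (hbB₀ : b₀ ∈ B₀) (hB₀src : ∀ b ∈ B₀, (a₀, b) ∈ e.source)
    (hζs : ζ.source = B₀) (hζval : ∀ b, ((ζ b : ↥T) : ↥U) = τ b) :
    ∃ (eT : OpenPartialHomeomorph (A × ↥T) ↥U) (t₀ : ↥T), (t₀ : ↥U) = τ b₀ ∧ (a₀, t₀) ∈ eT.source ∧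
      (∀ p ∈ eT.source, eT p = s p.1 * (p.2 : ↥U) * (s p.1)⁻¹) ∧
      ∀ N ∈ 𝓝 (a₀, t₀), ∃ (K : Set A) (B₁ : Set ↥T), IsCompact K ∧ IsOpen K ∧ a₀ ∈ K ∧ IsCompact B₁ ∧ IsOpen B₁ ∧ t₀ ∈ B₁ ∧
        K ×ˢ B₁ ⊆ N ∧ K ×ˢ B₁ ⊆ eT.source ∧
        (∀ t ∈ B₁, ∀ x : ↥U, x * (t : ↥U) * x⁻¹ ∈ eT '' (K ×ˢ B₁) → x ∈ s '' K * (T : Set ↥U)) ∧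
        (∀ t ∈ B₁, ∀ t' ∈ B₁, ∀ y : ↥U, y * (t : ↥U) * y⁻¹ = (t' : ↥U) → y ∈ T) := by
  have hζfun : (ζ : B → ↥T) = fun b => ⟨τ b, hcomm b⟩ := funext fun b => Subtype.ext (hζval b)
  have hζc : Continuous (ζ : B → ↥T) := by
    rw [hζfun]
    exact hτ.subtype_mk _
  have hbζ : b₀ ∈ ζ.source := by rw [hζs]; exact hbB₀
  refine ⟨((OpenPartialHomeomorph.refl A).prod ζ.symm).trans e, ζ b₀, hζval b₀, ?_, ?_, ?_⟩
  · -- base point in the source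
    rw [OpenPartialHomeomorph.trans_source, OpenPartialHomeomorph.prod_source, OpenPartialHomeomorph.refl_source, ζ.symm_source]
    refine ⟨mk_mem_prod (mem_univ _) (ζ.map_source hbζ), ?_⟩
    show (a₀, ζ.symm (ζ b₀)) ∈ e.source
    rw [ζ.left_inv hbζ]
    exact hB₀src b₀ hbB₀
  · -- the formula on the source
    intro p hp
    rw [OpenPartialHomeomorph.trans_source, OpenPartialHomeomorph.prod_source, OpenPartialHomeomorph.refl_source, ζ.symm_source] at hp
    have hp2 : p.2 ∈ ζ.target := hp.1.2
    have hps : (p.1, ζ.symm p.2) ∈ e.source := hp.2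
    show e (p.1, ζ.symm p.2) = _
    rw [he _ hps]
    show s p.1 * τ (ζ.symm p.2) * (s p.1)⁻¹ = s p.1 * (p.2 : ↥U) * (s p.1)⁻¹
    rw [← hζval (ζ.symm p.2), ζ.right_inv hp2]
  · -- the box clause in group coordinates
    intro N hN
    have hΘ : Continuous fun q : A × B => (q.1, ζ q.2) := continuous_fst.prodMk (hζc.comp continuous_snd)
    have hN' : (fun q : A × B => (q.1, ζ q.2)) ⁻¹' N ∩ univ ×ˢ B₀ ∈ 𝓝 (a₀, b₀) :=
      inter_mem (hΘ.continuousAt.preimage_mem_nhds hN) (prod_mem_nhds univ_mem (hB₀o.mem_nhds hbB₀))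
    obtain ⟨K, B₁, hKc, hKo, haK, hB₁c, hB₁o, hbB, hKBN, hKBs, hsat, hsep⟩ := hbox _ hN'
    have hB₁B₀ : B₁ ⊆ B₀ := fun b hb => (hKBN (mk_mem_prod haK hb)).2.2
    have hB₁ζ : B₁ ⊆ ζ.source := by rw [hζs]; exact hB₁B₀
    have hsrcT : ∀ a b, (a, b) ∈ e.source → b ∈ B₀ → (a, ζ b) ∈ (((OpenPartialHomeomorph.refl A).prod ζ.symm).trans e).source := by
      intro a b hab hb
      have hbs : b ∈ ζ.source := by rw [hζs]; exact hb
      rw [OpenPartialHomeomorph.trans_source, OpenPartialHomeomorph.prod_source, OpenPartialHomeomorph.refl_source, ζ.symm_source]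
      refine ⟨mk_mem_prod (mem_univ _) (ζ.map_source hbs), ?_⟩
      show (a, ζ.symm (ζ b)) ∈ e.source
      rw [ζ.left_inv hbs]
      exact hab
    refine ⟨K, ζ '' B₁, hKc, hKo, haK, hB₁c.image hζc, ζ.isOpen_image_of_subset_source hB₁o hB₁ζ, ⟨b₀, hbB, rfl⟩, ?_, ?_, ?_, ?_⟩
    · rintro ⟨a, t⟩ ⟨ha, ⟨b, hb, rfl⟩⟩
      exact (hKBN (mk_mem_prod ha hb)).1
    · rintro ⟨a, t⟩ ⟨ha, ⟨b, hb, rfl⟩⟩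
      exact hsrcT a b (hKBs (mk_mem_prod ha hb)) (hB₁B₀ hb)
    · rintro t ⟨b, hb, rfl⟩ x hx
      obtain ⟨⟨a, t'⟩, ⟨ha, ⟨b', hb', rfl⟩⟩, hpx⟩ := hx
      have hb's : b' ∈ ζ.source := hB₁ζ hb'
      have hpx' : e (a, b') = x * τ b * x⁻¹ := by
        rw [← hζval b, ← hpx]
        show e (a, b') = e (a, ζ.symm (ζ b'))
        rw [ζ.left_inv hb's]
      exact hsat b hb x ⟨(a, b'), mk_mem_prod ha hb', hpx'⟩
    · rintro t ⟨b, hb, rfl⟩ t' ⟨b', hb', rfl⟩ y hy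
      rw [hζval, hζval] at hy
      exact hsep b hb b' hb' y hy

end Subgroup

/-! ## §2 The assembled head at a block-scalar frame -/

section Head

variable {E : Type*} [NontriviallyNormedField E] [CompleteSpace E] {n : Type*} [Fintype n] [DecidableEq n]

/-- **(D1) THE UNITARY SLICE DATUM AT A SINGULAR SEMISIMPLE POINT.** `E` a complete, proper, totally disconnected non-trivially normed field of characteristic
zero, `σ` continuous, `J` with unit determinant, `γ ∈ U = U(σ, J)` with an adapted frame `γ P = P · reindex e (a·1 ⊕ u·1)`, `a ≠ u` (so `γ` is semisimple with
two eigenvalues; at `γ = ι(a·1₂, u)` this is the (S1) point of Rogawski's Prop. 8.2.1).  There are a total continuous `s : A → U`, `s(X) = c(X)`, on the θ-skew unit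
ball `A ⊆ [γ, M]` (`s a₀ = 1` at `a₀ = 0`), and an `OpenPartialHomeomorph eT : A × Z_U(γ) → U` with `(a₀, γ) ∈ eT.source` and `eT(a, m) = s(a)·m·s(a)⁻¹` on its
source, such that EVERY neighbourhood of `(a₀, γ)` contains a compact-open box `K × B₁ ⊆ eT.source` (`a₀ ∈ K`, `γ ∈ B₁ ⊆ Z_U(γ)`) which is
(SAT) `x m x⁻¹ ∈ eT(K × B₁) ⇒ x ∈ s(K)·Z_U(γ)` and (SEP′) `y m y⁻¹ = m′`, `m, m′ ∈ B₁` ⇒ `y ∈ Z_U(γ)`.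
[cite: HarishChandra1970, Part II §5] [cite: Rogawski1990, §8.2 Prop. 8.2.1 pp. 112–116] [cite: Weyl1939, Ch. II §10] -/
theorem exists_unitary_sliceDatum [CharZero E] [ProperSpace E] [TotallyDisconnectedSpace E] (σ : E →+* E) (hσ : Continuous σ)
    {J : Matrix n n E} (hJ : IsUnit J.det) (γ : ↥(unitaryGroupOfForm σ J))
    {m o : Type*} [Fintype m] [DecidableEq m] [Fintype o] [DecidableEq o] {a u : E} (hau : a ≠ u) (P : GL n E) (eι : m ⊕ o ≃ n)
    (hP : ((γ : GL n E) : Matrix n n E) * P.val = P.val * Matrix.reindex eι eι (Matrix.fromBlocks (a • (1 : Matrix m m E)) 0 0 (u • (1 : Matrix o o E)))) :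
    ∃ (s : ↥{X : Matrix n n E | X ∈ LinearMap.range (LinearMap.mulLeft E ((γ : GL n E) : Matrix n n E) - LinearMap.mulRight E ((γ : GL n E) : Matrix n n E)) ∧ J⁻¹ * (X.map σ)ᵀ * J = -X ∧ ‖X‖ < 1} → ↥(unitaryGroupOfForm σ J)) (eT : OpenPartialHomeomorph (↥{X : Matrix n n E | X ∈ LinearMap.range (LinearMap.mulLeft E ((γ : GL n E) : Matrix n n E) - LinearMap.mulRight E ((γ : GL n E) : Matrix n n E)) ∧ J⁻¹ * (X.map σ)ᵀ * J = -X ∧ ‖X‖ < 1} × ↥(Subgroup.centralizer ({γ} : Set ↥(unitaryGroupOfForm σ J)))) ↥(unitaryGroupOfForm σ J)) (a₀ : ↥{X : Matrix n n E | X ∈ LinearMap.range (LinearMap.mulLeft E ((γ : GL n E) : Matrix n n E) - LinearMap.mulRight E ((γ : GL n E) : Matrix n n E)) ∧ J⁻¹ * (X.map σ)ᵀ * J = -X ∧ ‖X‖ < 1}) (t₀ : ↥(Subgroup.centralizer ({γ} : Set ↥(unitaryGroupOfForm σ J)))),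
      (∀ a, (((s a : ↥(unitaryGroupOfForm σ J)) : GL n E) : Matrix n n E) = cayley (a : Matrix n n E)) ∧ Continuous s ∧ (a₀ : Matrix n n E) = 0 ∧ s a₀ = 1 ∧
      (t₀ : ↥(unitaryGroupOfForm σ J)) = γ ∧ (a₀, t₀) ∈ eT.source ∧ (∀ p ∈ eT.source, eT p = s p.1 * (p.2 : ↥(unitaryGroupOfForm σ J)) * (s p.1)⁻¹) ∧
      ∀ N ∈ 𝓝 (a₀, t₀), ∃ (K : Set ↥{X : Matrix n n E | X ∈ LinearMap.range (LinearMap.mulLeft E ((γ : GL n E) : Matrix n n E) - LinearMap.mulRight E ((γ : GL n E) : Matrix n n E)) ∧ J⁻¹ * (X.map σ)ᵀ * J = -X ∧ ‖X‖ < 1}) (B₁ : Set ↥(Subgroup.centralizer ({γ} : Set ↥(unitaryGroupOfForm σ J)))), IsCompact K ∧ IsOpen K ∧ a₀ ∈ K ∧ IsCompact B₁ ∧ IsOpen B₁ ∧ t₀ ∈ B₁ ∧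
        K ×ˢ B₁ ⊆ N ∧ K ×ˢ B₁ ⊆ eT.source ∧
        (∀ t ∈ B₁, ∀ x : ↥(unitaryGroupOfForm σ J), x * (t : ↥(unitaryGroupOfForm σ J)) * x⁻¹ ∈ eT '' (K ×ˢ B₁) →
          x ∈ s '' K * (Subgroup.centralizer ({γ} : Set ↥(unitaryGroupOfForm σ J)) : Set ↥(unitaryGroupOfForm σ J))) ∧
        (∀ t ∈ B₁, ∀ t' ∈ B₁, ∀ y : ↥(unitaryGroupOfForm σ J), y * (t : ↥(unitaryGroupOfForm σ J)) * y⁻¹ = (t' : ↥(unitaryGroupOfForm σ J)) → y ∈ Subgroup.centralizer ({γ} : Set ↥(unitaryGroupOfForm σ J))) := by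
  -- (0) `γ` is annihilated by the separable `(X − a)(X − u)`
  set D : Matrix n n E := Matrix.reindex eι eι (Matrix.fromBlocks (a • (1 : Matrix m m E)) 0 0 (u • (1 : Matrix o o E))) with hD
  have hPP' : P.val * (P⁻¹).val = 1 := by rw [← Units.val_mul, mul_inv_cancel, Units.val_one]
  have hsubP : ∀ c : E, (((γ : GL n E) : Matrix n n E) - algebraMap E (Matrix n n E) c) * P.val = P.val * (D - algebraMap E (Matrix n n E) c) := fun c => by
    rw [sub_mul, hP, Matrix.mul_sub, Algebra.algebraMap_eq_smul_one, Matrix.smul_mul, Matrix.mul_smul, Matrix.one_mul, Matrix.mul_one]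
  have hre : ∀ c : E, D - algebraMap E (Matrix n n E) c =
      Matrix.reindex eι eι (Matrix.fromBlocks ((a - c) • (1 : Matrix m m E)) 0 0 ((u - c) • (1 : Matrix o o E))) := fun c => by
    ext i j
    rw [Matrix.sub_apply, hD, Matrix.reindex_apply, Matrix.reindex_apply, Matrix.submatrix_apply, Matrix.submatrix_apply,
      Algebra.algebraMap_eq_smul_one, Matrix.smul_apply, ← Matrix.submatrix_one_equiv eι.symm, Matrix.submatrix_apply, ← Matrix.fromBlocks_one]
    rcases eι.symm i with i' | i' <;> rcases eι.symm j with j' | j'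
    · simp only [Matrix.fromBlocks_apply₁₁, Matrix.smul_apply, Matrix.one_apply, smul_eq_mul, mul_ite, mul_one, mul_zero]
      split_ifs
      · rfl
      · exact sub_zero 0
    · simp only [Matrix.fromBlocks_apply₁₂, Matrix.zero_apply, smul_zero, sub_zero]
    · simp only [Matrix.fromBlocks_apply₂₁, Matrix.zero_apply, smul_zero, sub_zero]
    · simp only [Matrix.fromBlocks_apply₂₂, Matrix.smul_apply, Matrix.one_apply, smul_eq_mul, mul_ite, mul_one, mul_zero]
      split_ifs
      · rfl
      · exact sub_zero 0
  have hDD : (D - algebraMap E (Matrix n n E) a) * (D - algebraMap E (Matrix n n E) u) = 0 := by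
    rw [hre, hre, Matrix.reindex_apply, Matrix.reindex_apply, Matrix.submatrix_mul_equiv, Matrix.fromBlocks_multiply]
    simp only [sub_self, zero_smul, Matrix.zero_mul, Matrix.mul_zero, add_zero, Matrix.fromBlocks_zero]
    rfl
  have hγ' : (((γ : GL n E) : Matrix n n E) - algebraMap E (Matrix n n E) a) * (((γ : GL n E) : Matrix n n E) - algebraMap E (Matrix n n E) u) = 0 := by
    have h : (((γ : GL n E) : Matrix n n E) - algebraMap E (Matrix n n E) a) * (((γ : GL n E) : Matrix n n E) - algebraMap E (Matrix n n E) u) * P.val = 0 := by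
      rw [Matrix.mul_assoc, hsubP u, ← Matrix.mul_assoc, hsubP a, Matrix.mul_assoc, hDD, Matrix.mul_zero]
    calc _ = (((γ : GL n E) : Matrix n n E) - algebraMap E (Matrix n n E) a) * (((γ : GL n E) : Matrix n n E) - algebraMap E (Matrix n n E) u) *
          P.val * (P⁻¹).val := by rw [Matrix.mul_assoc _ P.val, hPP', Matrix.mul_one]
      _ = 0 := by rw [h, Matrix.zero_mul]
  have hp : ((X - Polynomial.C a) * (X - Polynomial.C u)).Separable :=
    (Polynomial.separable_X_sub_C (x := a)).mul (Polynomial.separable_X_sub_C (x := u))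
      (Polynomial.isCoprime_X_sub_C_of_isUnit_sub (sub_ne_zero.2 hau).isUnit)
  have hγ : Polynomial.aeval ((γ : GL n E) : Matrix n n E) ((X - Polynomial.C a) * (X - Polynomial.C u)) = 0 := by
    rw [map_mul, map_sub, map_sub, Polynomial.aeval_X, Polynomial.aeval_C, Polynomial.aeval_C]
    exact hγ'
  -- (1) the slice chart of part I and the group coordinate of part II
  obtain ⟨s, τ, e, a₀, b₀, hsval, hτval, hs, hτ, ha₀, hb₀, hs₀, hτ₀, hcomm, h₀, he⟩ :=
    exists_openPartialHomeomorph_unitary_sliceChart σ hσ hJ γ hp hγ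
  obtain ⟨B₀, ζ, hB₀o, hbB₀, hB₀src, hζs, hζval⟩ := exists_openPartialHomeomorph_sliceGroupCoordinate σ hJ γ τ hτval hτ hcomm e a₀ b₀ h₀
  -- (2) Weyl separation at `γ` (★ (W-s), frame form), pulled back along `b ↦ τ b`
  have hq : Tendsto (fun q : ↥{Y : Matrix n n E | Y ∈ LinearMap.ker (LinearMap.mulLeft E ((γ : GL n E) : Matrix n n E) - LinearMap.mulRight E ((γ : GL n E) : Matrix n n E)) ∧ J⁻¹ * (Y.map σ)ᵀ * J = -Y ∧ ‖Y‖ < 1} × ↥{Y : Matrix n n E | Y ∈ LinearMap.ker (LinearMap.mulLeft E ((γ : GL n E) : Matrix n n E) - LinearMap.mulRight E ((γ : GL n E) : Matrix n n E)) ∧ J⁻¹ * (Y.map σ)ᵀ * J = -Y ∧ ‖Y‖ < 1} => ((((τ q.1 : ↥(unitaryGroupOfForm σ J)) : GL n E) : Matrix n n E), (((τ q.2 : ↥(unitaryGroupOfForm σ J)) : GL n E) : Matrix n n E)))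
      (𝓝 (b₀, b₀)) (𝓝 (((γ : GL n E) : Matrix n n E), ((γ : GL n E) : Matrix n n E))) := by
    have h1 : Continuous fun b : ↥{Y : Matrix n n E | Y ∈ LinearMap.ker (LinearMap.mulLeft E ((γ : GL n E) : Matrix n n E) - LinearMap.mulRight E ((γ : GL n E) : Matrix n n E)) ∧ J⁻¹ * (Y.map σ)ᵀ * J = -Y ∧ ‖Y‖ < 1} => (((τ b : ↥(unitaryGroupOfForm σ J)) : GL n E) : Matrix n n E) :=
      (Units.continuous_val.comp continuous_subtype_val).comp hτ
    have h2 := ((h1.comp continuous_fst).prodMk (h1.comp continuous_snd)).continuousAt (x := (b₀, b₀))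
    simpa only [ContinuousAt, Function.comp_def, hτ₀] using h2
  have hW : ∀ᶠ q : ↥{Y : Matrix n n E | Y ∈ LinearMap.ker (LinearMap.mulLeft E ((γ : GL n E) : Matrix n n E) - LinearMap.mulRight E ((γ : GL n E) : Matrix n n E)) ∧ J⁻¹ * (Y.map σ)ᵀ * J = -Y ∧ ‖Y‖ < 1} × ↥{Y : Matrix n n E | Y ∈ LinearMap.ker (LinearMap.mulLeft E ((γ : GL n E) : Matrix n n E) - LinearMap.mulRight E ((γ : GL n E) : Matrix n n E)) ∧ J⁻¹ * (Y.map σ)ᵀ * J = -Y ∧ ‖Y‖ < 1} in 𝓝 (b₀, b₀), ∀ y : ↥(unitaryGroupOfForm σ J), y * τ q.1 = τ q.2 * y → y ∈ Subgroup.centralizer ({γ} : Set ↥(unitaryGroupOfForm σ J)) := by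
    filter_upwards [hq.eventually (eventually_commute_of_mul_eq_of_frame (K := E) hau P eι hP)] with q hq' y hy
    have hc : ∀ b : ↥{Y : Matrix n n E | Y ∈ LinearMap.ker (LinearMap.mulLeft E ((γ : GL n E) : Matrix n n E) - LinearMap.mulRight E ((γ : GL n E) : Matrix n n E)) ∧ J⁻¹ * (Y.map σ)ᵀ * J = -Y ∧ ‖Y‖ < 1}, Commute (((τ b : ↥(unitaryGroupOfForm σ J)) : GL n E) : Matrix n n E) ((γ : GL n E) : Matrix n n E) := fun b => by
      have h := Subgroup.mem_centralizer_singleton_iff.1 (hcomm b)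
      have h' := congrArg (fun g : ↥(unitaryGroupOfForm σ J) => ((g : GL n E) : Matrix n n E)) h
      simp only [Subgroup.coe_mul, Units.val_mul] at h'
      exact h'
    have hy' : (((y : ↥(unitaryGroupOfForm σ J)) : GL n E) : Matrix n n E) * (((τ q.1 : ↥(unitaryGroupOfForm σ J)) : GL n E) : Matrix n n E) =
        (((τ q.2 : ↥(unitaryGroupOfForm σ J)) : GL n E) : Matrix n n E) * (((y : ↥(unitaryGroupOfForm σ J)) : GL n E) : Matrix n n E) := by
      have h' := congrArg (fun g : ↥(unitaryGroupOfForm σ J) => ((g : GL n E) : Matrix n n E)) hy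
      simpa only [Subgroup.coe_mul, Units.val_mul] using h'
    have key := hq' (hc q.1) (hc q.2) _ hy'
    rw [Subgroup.mem_centralizer_singleton_iff]
    exact Subtype.ext (Units.ext key.eq)
  -- (3) boxes on `A × B`, then group coordinates
  have hbox := exists_box_of_sliceDatum (Subgroup.centralizer ({γ} : Set ↥(unitaryGroupOfForm σ J))) s τ e (fun p _ => he p) h₀ hW
    (exists_isCompact_isOpen_nhds_skewBall σ hσ J _ a₀ ha₀) (exists_isCompact_isOpen_nhds_skewBall σ hσ J _ b₀ hb₀)
  obtain ⟨eT, t₀, ht₀, hsrc, hform, hboxT⟩ :=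
    exists_slice_groupDatum_of_sliceDatum (Subgroup.centralizer ({γ} : Set ↥(unitaryGroupOfForm σ J))) s τ hτ e (fun p _ => he p) hcomm hbox B₀ ζ hB₀o hbB₀ hB₀src hζs hζval
  exact ⟨s, eT, a₀, t₀, hsval, hs, ha₀, hs₀, by rw [ht₀, hτ₀], hsrc, hform, hboxT⟩

end Head


end Literature.NumberTheory.Automorphic
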